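import Mathlib.Analysis.Calculus.BumpFunction.Basic
import Mathlib.Analysis.Calculus.BumpFunction.InnerProduct
import Mathlib.Analysis.Calculus.ContDiff.Operations
import Mathlib.Topology.MetricSpace.Thickening
import HarnessLib

/-!
# Smooth cut-offs equal to one on a thickening of a compact set, and globally smooth extensions,
# in normed spaces carrying smooth bump functions (e.g. every real Hilbert space)

Analysis/FunctionSpaces support file (theorems only; no definitions, no named facts).

In a real normed space `E` with `HasContDiffBump E` — every real inner-product space
(`hasContDiffBump_of_innerProductSpace`, in particular `ℓ²` and every Sobolev-type Hilbert space of
states of a PDE) and every finite-dimensional space — we prove, for a COMPACT set `K` and radii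
`0 ≤ r < R`:

* `exists_contDiff_one_on_cthickening` — a `C^∞` function `χ : E → [0, 1]` with `χ = 1` on the
  closed `r`-thickening `Metric.cthickening r K` and `tsupport χ ⊆ Metric.thickening R K`;
* `contDiff_smul_of_tsupport_subset` — if `g` is `Cⁿ` on an open set `O` and `tsupport χ ⊆ O` for a
  `Cⁿ` scalar function `χ`, then `χ • g` (with `g` arbitrary off `O`) is `Cⁿ` on all of `E`;
* `exists_contDiff_eqOn_cthickening` — **smooth extension off a neighbourhood of a compact set**:
  a map `f : E → F` of class `Cⁿ` on the open `R`-thickening of `K` agrees on the closed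
  `r`-thickening of `K` with a GLOBALLY `Cⁿ` map `g : E → F`.

This is the infinite-dimensional substitute for the smooth Urysohn lemma (Mathlib's
`exists_contMDiffMap_zero_one_nhds_of_isClosed` and the tree's
`exists_contDiff_one_nhdsSet_zero_nhdsSet`, `exists_contDiff_tsupport_subset_eventuallyEq_one`,
`exists_contDiff_zero_one_of_isCompact` all require `FiniteDimensional ℝ E`, smooth partitions of
unity being available in Mathlib only on finite-dimensional / σ-compact manifolds).  Compactness of
`K` replaces local compactness of the space: cover `K` by finitely many balls `B(xᵢ, e)`,
`e = (R − r)/3`, take the bumps `φᵢ` centred at `xᵢ` equal to `1` on `B̄(xᵢ, r + 2e)` and supported in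
`B̄(xᵢ, r + 5e/2)`, and set `χ = 1 − ∏ᵢ (1 − φᵢ)`.  Typical use (dynamical systems in Hilbert space,
e.g. Poincaré / polysection maps of parabolic semiflows, Hale–Lin 1986 §8; Pilyugin 1999 §1.3.4):
a map defined and `C¹` only on a neighbourhood of a compact invariant set is replaced by a globally
`C¹` map with the same germ along the set.

## Mathlib / tree search

Mathlib (this pin): `ContDiffBump` (`one_of_mem_closedBall`, `zero_of_le_dist`, `nonneg`, `le_one`,
`contDiff`), `hasContDiffBump_of_innerProductSpace`, `finite_cover_balls_of_compact`,
`Metric.cthickening_subset_iUnion_closedBall_of_lt`, `Metric.mem_thickening_iff`, `contDiff_prod`;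
no cut-off attached to a compact set without `FiniteDimensional`.  Tree (`lean search
'HasContDiffBump'`, `'exists_contDiff.*nhdsSet|zero_one'`): only finite-dimensional versions
(`NSLocalLerayFarFieldTrace`, `ClassicalSuitableRegion`, `PoincareLemmaStarConvex`,
`InverseMeanCurvatureFlowWeakGradient`, `SmoothCutoff`).

## References

Folklore (smooth bump functions in Hilbert space: e.g. Lang, *Differential and Riemannian
Manifolds*, Ch. II §3; the product trick is the standard finite partition-of-unity step).
-/

noncomputable section

open Set Metric Function Filter
open scoped Topology ContDiff

namespace Literature.Analysis.FunctionSpaces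

variable {E : Type*} [NormedAddCommGroup E] [NormedSpace ℝ E]
variable {F : Type*} [NormedAddCommGroup F] [NormedSpace ℝ F]

/-! ## Localisation by a cut-off is globally smooth -/

/-- **Localisation is globally smooth.** If `g` is `Cⁿ` on an open set `O` and `χ` is a `Cⁿ`
scalar function with `tsupport χ ⊆ O`, then `x ↦ χ x • g x` (with `g` arbitrary off `O`) is `Cⁿ` on
the whole space: near points of `O` it is a product of `Cⁿ` functions, near the other points it
vanishes identically.  (General-normed-space twin of the tree's finite-dimensional
`contDiff_cutoff_smul_of_contDiffOn`.) [folklore] -/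
theorem contDiff_smul_of_tsupport_subset {n : WithTop ℕ∞} {χ : E → ℝ} {g : E → F} {O : Set E}
    (hO : IsOpen O) (hχ : ContDiff ℝ n χ) (hχO : tsupport χ ⊆ O) (hg : ContDiffOn ℝ n g O) :
    ContDiff ℝ n fun x => χ x • g x := by
  rw [contDiff_iff_contDiffAt]
  intro x
  by_cases hx : x ∈ O
  · exact hχ.contDiffAt.smul (hg.contDiffAt (hO.mem_nhds hx))
  · have hx' : x ∉ tsupport χ := fun h => hx (hχO h)
    have h0 : (fun y => χ y • g y) =ᶠ[𝓝 x] fun _ => 0 := by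
      filter_upwards [notMem_tsupport_iff_eventuallyEq.1 hx'] with y hy
      simp [hy]
    exact contDiffAt_const.congr_of_eventuallyEq h0

/-! ## Cut-offs equal to one on a thickening of a compact set -/

variable [HasContDiffBump E]

/-- **Smooth cut-off equal to `1` on the closed `r`-thickening of a compact set, supported in its
open `R`-thickening** (`0 ≤ r < R`), with values in `[0, 1]`, in any real normed space with smooth
bump functions (every real inner-product space, every finite-dimensional space).  Construction:
`χ = 1 − ∏ᵢ (1 − φᵢ)` over a finite cover of `K` by balls `B(xᵢ, e)`, `e = (R − r)/3`, `φᵢ` the bump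
at `xᵢ` with radii `r + 2e < r + 5e/2`. [folklore] -/
theorem exists_contDiff_one_on_cthickening {K : Set E} (hK : IsCompact K) {r R : ℝ} (hr : 0 ≤ r)
    (hrR : r < R) :
    ∃ χ : E → ℝ, ContDiff ℝ ∞ χ ∧ (∀ x ∈ cthickening r K, χ x = 1) ∧
      tsupport χ ⊆ thickening R K ∧ ∀ x, χ x ∈ Icc (0 : ℝ) 1 := by
  -- a finite cover of `K` by small balls
  set e : ℝ := (R - r) / 3 with he
  have he0 : 0 < e := by rw [he]; linarith
  obtain ⟨t, htK, htfin, hKt⟩ := finite_cover_balls_of_compact hK he0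
  -- the bumps
  have hIn : 0 < r + 2 * e := by linarith
  have hInOut : r + 2 * e < r + 5 / 2 * e := by linarith
  let b : ∀ x : E, ContDiffBump x := fun x => ⟨r + 2 * e, r + 5 / 2 * e, hIn, hInOut⟩
  set s : Finset E := htfin.toFinset with hs
  have hmem : ∀ {x}, x ∈ s ↔ x ∈ t := fun {x} => by rw [hs, Set.Finite.mem_toFinset]
  refine ⟨fun y => 1 - ∏ x ∈ s, (1 - b x y), ?_, ?_, ?_, ?_⟩
  · -- smoothness
    exact contDiff_const.sub (contDiff_prod fun x _ => contDiff_const.sub (b x).contDiff)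
  · -- `χ = 1` on the closed `r`-thickening
    intro y hy
    have hy' : y ∈ ⋃ x ∈ K, closedBall x (r + e / 2) :=
      cthickening_subset_iUnion_closedBall_of_lt K (by linarith) (by linarith) hy
    obtain ⟨k, hk, hyk⟩ := mem_iUnion₂.1 hy'
    obtain ⟨x, hx, hkx⟩ := mem_iUnion₂.1 (hKt hk)
    have hxs : x ∈ s := hmem.2 hx
    have hyx : y ∈ closedBall x (b x).rIn := by
      rw [mem_closedBall]
      have h1 : dist y k ≤ r + e / 2 := mem_closedBall.1 hyk
      have h2 : dist k x < e := mem_ball.1 hkx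
      calc dist y x ≤ dist y k + dist k x := dist_triangle _ _ _
        _ ≤ r + 2 * e := by linarith
    have hzero : (1 - b x y) = 0 := by rw [(b x).one_of_mem_closedBall hyx, sub_self]
    have hprod : ∏ x ∈ s, (1 - b x y) = 0 := Finset.prod_eq_zero hxs hzero
    show 1 - ∏ x ∈ s, (1 - b x y) = 1
    rw [hprod, sub_zero]
  · -- support inside the open `R`-thickening
    have hsupp : support (fun y => 1 - ∏ x ∈ s, (1 - b x y)) ⊆
        ⋃ x ∈ s, closedBall x (r + 5 / 2 * e) := by
      intro y hy
      rw [mem_support] at hy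
      by_contra hy'
      apply hy
      have hall : ∀ x ∈ s, (1 - b x y) = 1 := by
        intro x hx
        have hyx : (b x).rOut ≤ dist y x := by
          by_contra hlt
          exact hy' (mem_iUnion₂.2 ⟨x, hx, mem_closedBall.2 (le_of_lt (not_le.1 hlt))⟩)
        rw [(b x).zero_of_le_dist hyx, sub_zero]
      rw [Finset.prod_eq_one hall, sub_self]
    have hclosed : IsClosed (⋃ x ∈ s, closedBall x (r + 5 / 2 * e)) :=
      s.finite_toSet.isClosed_biUnion fun _ _ => isClosed_closedBall
    refine (closure_minimal hsupp hclosed).trans ?_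
    intro y hy
    obtain ⟨x, hx, hyx⟩ := mem_iUnion₂.1 hy
    have hxK : x ∈ K := htK (hmem.1 hx)
    rw [mem_thickening_iff]
    refine ⟨x, hxK, ?_⟩
    calc dist y x ≤ r + 5 / 2 * e := mem_closedBall.1 hyx
      _ < R := by rw [he]; linarith
  · -- values in `[0, 1]`
    intro y
    have h0 : 0 ≤ ∏ x ∈ s, (1 - b x y) :=
      Finset.prod_nonneg fun x _ => sub_nonneg.2 (b x).le_one
    have h1 : ∏ x ∈ s, (1 - b x y) ≤ 1 :=
      Finset.prod_le_one (fun x _ => sub_nonneg.2 (b x).le_one)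
        fun x _ => sub_le_self _ (b x).nonneg
    exact ⟨by linarith, by linarith⟩

/-- **Globally smooth extension off a neighbourhood of a compact set.**  If `f : E → F` is `Cⁿ` on
the open `R`-thickening of a compact set `K` (`n ≤ ∞`) and `0 ≤ r < R`, there is a globally `Cⁿ` map
`g : E → F` that agrees with `f` on the closed `r`-thickening of `K` (hence has the same derivatives
as `f` on the open `r`-thickening).  `g = χ • f` for the cut-off of
`exists_contDiff_one_on_cthickening`. [folklore] -/
theorem exists_contDiff_eqOn_cthickening {n : ℕ∞} {K : Set E} (hK : IsCompact K) {r R : ℝ}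
    (hr : 0 ≤ r) (hrR : r < R) {f : E → F} (hf : ContDiffOn ℝ n f (thickening R K)) :
    ∃ g : E → F, ContDiff ℝ n g ∧ EqOn g f (cthickening r K) := by
  obtain ⟨χ, hχ, h1, hsupp, -⟩ := exists_contDiff_one_on_cthickening hK hr hrR
  refine ⟨fun x => χ x • f x, ?_, fun x hx => by simp [h1 x hx]⟩
  have hχn : ContDiff ℝ n χ := hχ.of_le (mod_cast le_top)
  exact contDiff_smul_of_tsupport_subset isOpen_thickening hχn hsupp hf

/-- The extension of `exists_contDiff_eqOn_cthickening` in the form used for maps that are honest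
only near a compact set: `g = f` on a NEIGHBOURHOOD of the closed `r`-thickening (namely on the open
`r'`-thickening for any `r < r' < R`), so that `fderiv ℝ g = fderiv ℝ f` there. [folklore] -/
theorem exists_contDiff_eqOn_thickening {n : ℕ∞} {K : Set E} (hK : IsCompact K) {r R : ℝ}
    (hr : 0 ≤ r) (hrR : r < R) {f : E → F} (hf : ContDiffOn ℝ n f (thickening R K)) :
    ∃ g : E → F, ContDiff ℝ n g ∧ EqOn g f (thickening ((r + R) / 2) K) ∧
      ∀ x ∈ thickening ((r + R) / 2) K, fderiv ℝ g x = fderiv ℝ f x := by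
  obtain ⟨g, hg, heq⟩ := exists_contDiff_eqOn_cthickening (n := n) hK (r := (r + R) / 2)
    (by linarith) (by linarith) hf
  have heq' : EqOn g f (thickening ((r + R) / 2) K) :=
    fun x hx => heq (thickening_subset_cthickening _ _ hx)
  refine ⟨g, hg, heq', fun x hx => ?_⟩
  exact Filter.EventuallyEq.fderiv_eq (heq'.eventuallyEq_of_mem (isOpen_thickening.mem_nhds hx))

end Literature.Analysis.FunctionSpaces

end
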